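import Literature.MathematicalPhysics.QuantumManyBody.PeriodicMaxFormPositivity
import Literature.Analysis.InnerProduct.CompactEmbeddingGraphNorm
import HarnessLib
-- module: Literature.MathematicalPhysics.QuantumManyBody.PeriodicSlotDepletion

/-!
# The zero-mode depletion `N - n̂₀` on `L²((ℝ/ℤ)^{3N})` and the rewarded maximal form

Topic `Literature/MathematicalPhysics/QuantumManyBody`, sequel of `PeriodicMaxFormGroundStates.lean` /
`PeriodicMaxFormPositivity.lean` (the maximal form `maxForm v L` of the periodic `N`-boson Hamiltonian on
`H = L²((ℝ/ℤ)^{3N})`, Haar probability measure, Hilbert basis `eₙ = mFourierLp 2 n`). Definitions file of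
the REWARDED max-form package (`PeriodicRewardedFormSpectrum.lean`, `PeriodicRewardedMaxFormGroundStates.lean`,
`PeriodicRewardedMaxFormPositivity.lean`, `PeriodicRewardedMaxFormSimplicity.lean`): the Perron–Frobenius /
Faris–Simon theory of Reed–Simon §XIII.12 for the form `⟨Ψ, HΨ⟩ + s(N - ⟨Ψ, n̂₀Ψ⟩)`, `s ≥ 0`, where
`n̂₀ = a₀†a₀ = ∑ᵢ Pᵢ` is the number of particles in the constant one-particle mode (`Pᵢ` = average over
the `i`-th particle) [LSSY2005, App. A (A.10)–(A.13)].

**The depletion operator.** For a slot `i : Fin N`, the *excited subspace* `exciteSubspace N i ⊆ H` is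
the closed span of the plane waves `eₙ` with `n_{(i,·)} ≠ 0` — the classes orthogonal to every function
that is constant in the `i`-th particle — and `exciteProj N i = 1 - Pᵢ` is its orthogonal projection
(`Submodule.starProjection`), diagonal in the Fourier basis: `⟪eₙ, (1 - Pᵢ)η⟫ = 𝟙[n_{(i,·)} ≠ 0] ⟪eₙ, η⟫`
(`inner_mFourierLp_exciteProj`). The **depletion** `depletion N η = ∑ᵢ ‖(1 - Pᵢ)η‖²` is the quadratic
form of `N - n̂₀` (`= ∑ᵢ ∑ₙ 𝟙[n_{(i,·)} ≠ 0] |⟪eₙ, η⟫|²`, `depletion_eq_sum_tsum`), realised as `‖depMap N η‖²`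
for the bounded map `depMap N : H →L ⨁ᵢ H`, `η ↦ ((1 - Pᵢ)η)ᵢ`; `depletionB` is its polarisation.
Elementary consequences: `0 ≤ depletion ≤ N‖η‖²`, homogeneity, parallelogram law, local Lipschitz bound
`|dep x - dep y| ≤ N(‖x‖ + ‖y‖)‖x - y‖`, continuity, the line expansion
`dep(η + tξ) = dep η + 2t depB(η, ξ) + t² dep ξ`, and `(1 - Pᵢ)e₀ = 0`.

**The rewarded form.** `maxFormR s v L η = maxForm v L η + s·depletion N η`; on the form domain `Q` of
`PeriodicFormDomain.lean`, `rewardG hL hv hW s = √s · depMap ∘ ι : Q →L ⨁ᵢ H` (`‖rewardG u‖² = s·dep(ιu)`),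
whose graph Hilbert space `graphSpace (rewardG hL hv hW s)`
(`Literature/Analysis/InnerProduct/CompactEmbeddingGraphNorm.lean`) is the form domain of the rewarded
form, with embedding `graphEmbedding (formEmbed hL hv hW) (rewardG hL hv hW s)` (named `NormedAddCommGroup` /
`InnerProductSpace` instances are registered for `Q` and for this graph space, so that `TwoModeData` of the
rewarded embedding elaborates); for periodic trial states `rewardedEnergy hL hv hW s Ψ = periodicEnergy v Ψ
+ s·dep(ιΨ)`, its infimum `rewardedGroundStateEnergy`, and the rewarded ground-state class
`rewardedGroundStates = {η ∈ boseSymmetric N | maxFormR s v L η ≤ R ‖η‖²}`.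
(The dictionary `dep(ιΨ) = N - condensateOccupation N L Ψ` for trial states is the Bose-symmetric
Fourier bookkeeping of the Summit file `…EndpointTransferOccupationFourier`; it is not needed here.)

## References

* E. H. Lieb, R. Seiringer, J. P. Solovej, J. Yngvason, *The Mathematics of the Bose Gas and its
  Condensation* (2005), App. A. [LSSY2005]
* M. Reed, B. Simon, *Methods of Modern Mathematical Physics IV* (1978), §XIII.12. [ReedSimonIV1978]
* T. Kato, *Perturbation Theory for Linear Operators* (1966), Ch. VI §1.6. [Kato1966]
-/

noncomputable section

open MeasureTheory Filter Set Complex UnitAddTorus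
open scoped ENNReal NNReal Topology InnerProductSpace ComplexConjugate
open Literature.Analysis.FunctionSpaces Literature.Analysis.OperatorTheory Literature.Analysis.InnerProduct

namespace Literature.MathematicalPhysics.QuantumManyBody.BoseGas

-- The measure on `ℝ/ℤ` is the Haar PROBABILITY measure, as in `PeriodicFormDomain.lean`.
attribute [local instance] formDomain_measureSpace formDomain_isProbabilityMeasure formDomain_isProbabilityMeasure_pi

variable {N : ℕ} {L : ℝ} {v : ℝ → ℝ≥0∞}

/-- Local notation for the Hilbert space `L²((ℝ/ℤ)^{3N})`, as in `PeriodicFormDomain.lean`. -/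
local notation "L2T " N':max => Lp ℂ 2 (volume : Measure (UnitAddTorus (Fin N' × Fin 3)))

/-! ### The excited subspace of a slot and its projection `1 - Pᵢ` -/

/-- **The excited subspace of the `i`-th particle**: the classes `η ∈ L²((ℝ/ℤ)^{3N})` all of whose Fourier
coefficients at momenta `n` with `n_{(i,·)} = 0` vanish, i.e. the orthogonal complement of the functions
that do not depend on the `i`-th particle (the range of `1 - Pᵢ`, `Pᵢ` = average over particle `i`).
[cite: LSSY2005, App. A (A.10)–(A.13)] -/
def exciteSubspace (N : ℕ) (i : Fin N) : Submodule ℂ (L2T N) where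
  carrier := {η | ∀ n : Fin N × Fin 3 → ℤ, (fun k => n (i, k)) = 0 → ⟪(mFourierLp 2 n : L2T N), η⟫_ℂ = 0}
  zero_mem' := fun n _ => inner_zero_right _
  add_mem' := fun ha hb n hn => by rw [inner_add_right, ha n hn, hb n hn, add_zero]
  smul_mem' := fun c x hx n hn => by
    show ⟪_, c • x⟫_ℂ = 0
    rw [inner_smul_right, hx n hn, mul_zero]

/-- Membership in the excited subspace. [folklore] -/
theorem mem_exciteSubspace {i : Fin N} {η : L2T N} :
    η ∈ exciteSubspace N i ↔ ∀ n : Fin N × Fin 3 → ℤ, (fun k => n (i, k)) = 0 →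
      ⟪(mFourierLp 2 n : L2T N), η⟫_ℂ = 0 := Iff.rfl

/-- The excited subspace is closed. [folklore] -/
theorem isClosed_exciteSubspace (i : Fin N) : IsClosed (exciteSubspace N i : Set (L2T N)) := by
  have h : (exciteSubspace N i : Set (L2T N)) = ⋂ n : Fin N × Fin 3 → ℤ, ⋂ (_ : (fun k => n (i, k)) = 0),
      {η : L2T N | ⟪(mFourierLp 2 n : L2T N), η⟫_ℂ = 0} := by
    ext η
    simp only [SetLike.mem_coe, mem_exciteSubspace, mem_iInter, mem_setOf_eq]
  rw [h]
  exact isClosed_iInter fun n => isClosed_iInter fun _ => isClosed_eq (continuous_const.inner continuous_id) continuous_const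

/-- The excited subspace is complete (so it has an orthogonal projection). [folklore] -/
instance exciteSubspace.instCompleteSpace (i : Fin N) : CompleteSpace (exciteSubspace N i) :=
  (isClosed_exciteSubspace i).completeSpace_coe

/-- **The projection `1 - Pᵢ`** onto the excited subspace of the `i`-th particle. [cite: LSSY2005, App. A (A.13)] -/
def exciteProj (N : ℕ) (i : Fin N) : L2T N →L[ℂ] L2T N := (exciteSubspace N i).starProjection

/-- Unfolding `exciteProj` (made irreducible at the end of this file). [folklore] -/
theorem exciteProj_def (N : ℕ) (i : Fin N) : exciteProj N i = (exciteSubspace N i).starProjection := rfl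

/-- Plane waves with `n_{(i,·)} ≠ 0` are excited in slot `i`. [folklore] -/
theorem mFourierLp_mem_exciteSubspace {i : Fin N} {n : Fin N × Fin 3 → ℤ} (hn : (fun k => n (i, k)) ≠ 0) :
    (mFourierLp 2 n : L2T N) ∈ exciteSubspace N i := fun m hm => by
  rw [orthonormal_iff_ite.1 orthonormal_mFourier]
  exact if_neg fun h => hn (by rw [← h]; exact hm)

/-- **`1 - Pᵢ` is diagonal in the Fourier basis**: `⟪eₙ, (1 - Pᵢ)η⟫ = 𝟙[n_{(i,·)} ≠ 0] ⟪eₙ, η⟫`.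
[cite: LSSY2005, App. A (A.13)] -/
theorem inner_mFourierLp_exciteProj (i : Fin N) (η : L2T N) (n : Fin N × Fin 3 → ℤ) :
    ⟪(mFourierLp 2 n : L2T N), exciteProj N i η⟫_ℂ =
      if (fun k => n (i, k)) = 0 then 0 else ⟪(mFourierLp 2 n : L2T N), η⟫_ℂ := by
  split_ifs with hn
  · exact (Submodule.starProjection_apply_mem (exciteSubspace N i) η) n hn
  · rw [exciteProj, ← Submodule.inner_starProjection_left_eq_right,
      Submodule.starProjection_eq_self_iff.2 (mFourierLp_mem_exciteSubspace hn)]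

/-- `‖(1 - Pᵢ)η‖ ≤ ‖η‖`. [folklore] -/
theorem norm_exciteProj_le (i : Fin N) (η : L2T N) : ‖exciteProj N i η‖ ≤ ‖η‖ :=
  Submodule.norm_starProjection_apply_le _ η

/-- `⟪(1 - Pᵢ)η, (1 - Pᵢ)ξ⟫ = ⟪(1 - Pᵢ)η, ξ⟫`. [folklore] -/
theorem inner_exciteProj_exciteProj (i : Fin N) (η ξ : L2T N) :
    ⟪exciteProj N i η, exciteProj N i ξ⟫_ℂ = ⟪exciteProj N i η, ξ⟫_ℂ := by
  rw [exciteProj, ← Submodule.inner_starProjection_left_eq_right,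
    Submodule.starProjection_eq_self_iff.2 (Submodule.starProjection_apply_mem _ η)]

/-- **Parseval for `(1 - Pᵢ)η` against `ξ`**: `⟪(1 - Pᵢ)η, ξ⟫ = ∑ₙ 𝟙[n_{(i,·)} ≠ 0] conj⟪eₙ, η⟫ ⟪eₙ, ξ⟫`. [folklore] -/
theorem hasSum_inner_exciteProj (i : Fin N) (η ξ : L2T N) :
    HasSum (fun n : Fin N × Fin 3 → ℤ => if (fun k => n (i, k)) = 0 then 0 else
      conj ⟪(mFourierLp 2 n : L2T N), η⟫_ℂ * ⟪(mFourierLp 2 n : L2T N), ξ⟫_ℂ) ⟪exciteProj N i η, ξ⟫_ℂ := by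
  have h := (mFourierBasis (d := Fin N × Fin 3)).hasSum_inner_mul_inner (exciteProj N i η) ξ
  refine h.congr_fun fun n => ?_
  rw [coe_mFourierBasis, ← inner_conj_symm (exciteProj N i η) (mFourierLp 2 n : L2T N), inner_mFourierLp_exciteProj]
  split_ifs with hn
  · rw [map_zero, zero_mul]
  · rw [inner_conj_symm]

/-- **Parseval for `‖(1 - Pᵢ)η‖²`**: `‖(1 - Pᵢ)η‖² = ∑ₙ 𝟙[n_{(i,·)} ≠ 0] |⟪eₙ, η⟫|²`. [folklore] -/
theorem hasSum_norm_exciteProj_sq (i : Fin N) (η : L2T N) :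
    HasSum (fun n : Fin N × Fin 3 → ℤ => if (fun k => n (i, k)) = 0 then 0 else
      ‖⟪(mFourierLp 2 n : L2T N), η⟫_ℂ‖ ^ 2) (‖exciteProj N i η‖ ^ 2) := by
  refine (HaarTorus.hasSum_sq_norm_inner_mFourierLp (exciteProj N i η)).congr_fun fun n => ?_
  rw [inner_mFourierLp_exciteProj]
  split_ifs <;> simp

/-- `(1 - Pᵢ)e₀ = 0` (the constant is fully condensed). [folklore] -/
theorem exciteProj_mFourierLp_zero (i : Fin N) : exciteProj N i (mFourierLp 2 (0 : Fin N × Fin 3 → ℤ) : L2T N) = 0 := by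
  refine Lp_eq_of_forall_inner_mFourierLp_eq fun n => ?_
  rw [inner_mFourierLp_exciteProj, inner_zero_right]
  split_ifs with hn
  · rfl
  · rw [orthonormal_iff_ite.1 orthonormal_mFourier, if_neg]
    rintro rfl
    exact hn rfl

/-! ### The depletion map, the depletion and its polarisation -/

/-- **The depletion map** `η ↦ ((1 - Pᵢ)η)ᵢ ∈ ⨁ᵢ L²` (so that `‖depMap N η‖²` is the quadratic form of
`N - n̂₀`). [cite: LSSY2005, App. A (A.13)] -/
def depMap (N : ℕ) : L2T N →L[ℂ] PiLp 2 (fun _ : Fin N => L2T N) :=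
  (PiLp.continuousLinearEquiv 2 ℂ (fun _ : Fin N => L2T N)).symm.toContinuousLinearMap ∘L
    ContinuousLinearMap.pi fun i => exciteProj N i

/-- The components of the depletion map. [folklore] -/
@[simp] theorem depMap_apply (η : L2T N) (i : Fin N) : depMap N η i = exciteProj N i η := rfl

/-- **The depletion** `∑ᵢ ‖(1 - Pᵢ)η‖² = ⟨η, (N - n̂₀)η⟩`. [cite: LSSY2005, App. A (A.13)] -/
def depletion (N : ℕ) (η : L2T N) : ℝ := ∑ i : Fin N, ‖exciteProj N i η‖ ^ 2

/-- **The depletion pairing** (real polarisation of `depletion`): `∑ᵢ re⟪(1 - Pᵢ)η, (1 - Pᵢ)ξ⟫`. [folklore] -/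
def depletionB (N : ℕ) (η ξ : L2T N) : ℝ := ∑ i : Fin N, (⟪exciteProj N i η, exciteProj N i ξ⟫_ℂ).re

/-- Unfolding `depletion` (the definition is made irreducible at the end of this file). [folklore] -/
theorem depletion_def (η : L2T N) : depletion N η = ∑ i : Fin N, ‖exciteProj N i η‖ ^ 2 := rfl

/-- Unfolding `depletionB`. [folklore] -/
theorem depletionB_def (η ξ : L2T N) : depletionB N η ξ = ∑ i : Fin N, (⟪exciteProj N i η, exciteProj N i ξ⟫_ℂ).re := rfl

/-- `‖depMap N η‖² = depletion N η`. [folklore] -/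
theorem norm_depMap_sq (η : L2T N) : ‖depMap N η‖ ^ 2 = depletion N η := by
  rw [PiLp.norm_sq_eq_of_L2]
  rfl

/-- `0 ≤ depletion`. [folklore] -/
theorem depletion_nonneg (η : L2T N) : 0 ≤ depletion N η := Finset.sum_nonneg fun _ _ => sq_nonneg _

/-- `depletion N η ≤ N ‖η‖²` (`N - n̂₀ ≤ N`). [folklore] -/
theorem depletion_le (η : L2T N) : depletion N η ≤ N * ‖η‖ ^ 2 := by
  refine (Finset.sum_le_sum fun i _ => pow_le_pow_left₀ (norm_nonneg _) (norm_exciteProj_le i η) 2).trans_eq ?_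
  rw [Finset.sum_const, Finset.card_univ, Fintype.card_fin, nsmul_eq_mul]

/-- `depletion 0 = 0`. [folklore] -/
theorem depletion_zero : depletion N (0 : L2T N) = 0 := by simp [depletion]

/-- `depletion (c • η) = |c|² depletion η`. [folklore] -/
theorem depletion_smul (c : ℂ) (η : L2T N) : depletion N (c • η) = ‖c‖ ^ 2 * depletion N η := by
  simp only [depletion, map_smul, norm_smul, mul_pow, Finset.mul_sum]

/-- **Parallelogram law of the depletion.** [folklore] -/
theorem depletion_parallelogram (η ξ : L2T N) :
    depletion N (η + ξ) + depletion N (η - ξ) = 2 * depletion N η + 2 * depletion N ξ := by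
  rw [← norm_depMap_sq, ← norm_depMap_sq, ← norm_depMap_sq, ← norm_depMap_sq, map_add, map_sub]
  have h := parallelogram_law_with_norm ℂ (depMap N η) (depMap N ξ)
  simp only [sq]
  linarith

/-- **The depletion is locally Lipschitz**: `|dep x - dep y| ≤ N (‖x‖ + ‖y‖) ‖x - y‖`. [folklore] -/
theorem abs_depletion_sub_depletion_le (x y : L2T N) :
    |depletion N x - depletion N y| ≤ N * (‖x‖ + ‖y‖) * ‖x - y‖ := by
  rw [depletion, depletion, ← Finset.sum_sub_distrib]
  refine (Finset.abs_sum_le_sum_abs _ _).trans ?_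
  have hi : ∀ i : Fin N, |‖exciteProj N i x‖ ^ 2 - ‖exciteProj N i y‖ ^ 2| ≤ (‖x‖ + ‖y‖) * ‖x - y‖ := by
    intro i
    rw [sq_sub_sq, abs_mul]
    refine mul_le_mul ?_ ?_ (abs_nonneg _) (by positivity)
    · rw [abs_of_nonneg (by positivity)]
      exact add_le_add (norm_exciteProj_le i x) (norm_exciteProj_le i y)
    · refine (abs_norm_sub_norm_le _ _).trans ?_
      rw [← map_sub]
      exact norm_exciteProj_le i (x - y)
  refine (Finset.sum_le_sum fun i _ => hi i).trans_eq ?_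
  rw [Finset.sum_const, Finset.card_univ, Fintype.card_fin, nsmul_eq_mul, mul_assoc]

/-- The depletion is continuous on `L²`. [folklore] -/
theorem continuous_depletion : Continuous (depletion N : L2T N → ℝ) :=
  continuous_finsetSum _ fun i _ => ((exciteProj N i).continuous.norm).pow 2

/-- `depletionB η η = depletion η`. [folklore] -/
theorem depletionB_self (η : L2T N) : depletionB N η η = depletion N η := by
  simp only [depletionB, depletion, inner_self_eq_norm_sq_to_K]
  refine Finset.sum_congr rfl fun i _ => ?_
  norm_cast

/-- **The line expansion of the depletion**: `dep(η + tξ) = dep η + 2t depB(η, ξ) + t² dep ξ` for real `t`.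
[folklore] -/
theorem depletion_add_ofReal_smul (η ξ : L2T N) (t : ℝ) :
    depletion N (η + (t : ℂ) • ξ) = depletion N η + 2 * t * depletionB N η ξ + t ^ 2 * depletion N ξ := by
  simp only [depletion, depletionB, map_add, map_smul, norm_add_ofReal_smul_sq, Finset.sum_add_distrib,
    Finset.mul_sum]

/-- The depletion pairing through `⟪(1 - Pᵢ)η, ξ⟫`. [folklore] -/
theorem depletionB_eq_sum_re_inner (η ξ : L2T N) :
    depletionB N η ξ = ∑ i : Fin N, (⟪exciteProj N i η, ξ⟫_ℂ).re := by
  simp only [depletionB, inner_exciteProj_exciteProj]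

/-- **The depletion pairing in the Fourier basis**:
`depB(η, ξ) = ∑ᵢ re ∑ₙ 𝟙[n_{(i,·)} ≠ 0] conj⟪eₙ, η⟫ ⟪eₙ, ξ⟫`. [folklore] -/
theorem depletionB_eq_sum_re_tsum (η ξ : L2T N) :
    depletionB N η ξ = ∑ i : Fin N, (∑' n : Fin N × Fin 3 → ℤ, if (fun k => n (i, k)) = 0 then 0 else
      conj ⟪(mFourierLp 2 n : L2T N), η⟫_ℂ * ⟪(mFourierLp 2 n : L2T N), ξ⟫_ℂ).re := by
  rw [depletionB_eq_sum_re_inner]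
  exact Finset.sum_congr rfl fun i _ => by rw [(hasSum_inner_exciteProj i η ξ).tsum_eq]

/-- **The depletion in the Fourier basis**: `dep η = ∑ᵢ ∑ₙ 𝟙[n_{(i,·)} ≠ 0] |⟪eₙ, η⟫|²`. [folklore] -/
theorem depletion_eq_sum_tsum (η : L2T N) :
    depletion N η = ∑ i : Fin N, ∑' n : Fin N × Fin 3 → ℤ, if (fun k => n (i, k)) = 0 then 0 else
      ‖⟪(mFourierLp 2 n : L2T N), η⟫_ℂ‖ ^ 2 :=
  Finset.sum_congr rfl fun i _ => (hasSum_norm_exciteProj_sq i η).tsum_eq.symm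

/-- The `ℝ≥0∞` form of Parseval for one slot: `ofReal ‖(1 - Pᵢ)η‖² = ∑ₙ 𝟙[n_{(i,·)} ≠ 0] ‖η̂(n)‖ₑ²`. [folklore] -/
theorem ofReal_norm_exciteProj_sq (i : Fin N) (η : L2T N) :
    ENNReal.ofReal (‖exciteProj N i η‖ ^ 2) = ∑' n : Fin N × Fin 3 → ℤ,
      if (fun k => n (i, k)) = 0 then 0 else ‖mFourierCoeff (η : UnitAddTorus (Fin N × Fin 3) → ℂ) n‖ₑ ^ 2 := by
  have h := hasSum_norm_exciteProj_sq i η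
  rw [← h.tsum_eq, ENNReal.ofReal_tsum_of_nonneg (fun n => by positivity) h.summable]
  refine tsum_congr fun n => ?_
  split_ifs
  · exact ENNReal.ofReal_zero
  · rw [HaarTorus.inner_mFourierLp_eq_mFourierCoeff, ← ofReal_norm, ENNReal.ofReal_pow (norm_nonneg _)]

/-- Adding a constant to the second argument does not change the depletion pairing. [folklore] -/
theorem depletionB_add_smul_mFourierLp_zero (η x : L2T N) (c : ℂ) :
    depletionB N η (x + c • (mFourierLp 2 (0 : Fin N × Fin 3 → ℤ) : L2T N)) = depletionB N η x := by
  simp only [depletionB, map_add, map_smul, exciteProj_mFourierLp_zero, smul_zero, add_zero]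

/-! ### The rewarded maximal form and the rewarded ground-state class -/

/-- **The rewarded maximal form** `maxForm v L η + s · depletion N η` of `-∑ⱼΔⱼ + W + s(N - n̂₀)`.
[cite: ReedSimonIV1978, §XIII.12] -/
def maxFormR (s : ℝ) (v : ℝ → ℝ≥0∞) (L : ℝ) (η : L2T N) : ℝ≥0∞ :=
  maxForm v L η + ENNReal.ofReal (s * depletion N η)

/-- Unfolding `maxFormR`. [folklore] -/
theorem maxFormR_def (s : ℝ) (v : ℝ → ℝ≥0∞) (L : ℝ) (η : L2T N) :
    maxFormR s v L η = maxForm v L η + ENNReal.ofReal (s * depletion N η) := rfl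

/-- `maxFormR (c • η) = |c|² maxFormR η`. [folklore] -/
theorem maxFormR_smul (s : ℝ) (v : ℝ → ℝ≥0∞) (L : ℝ) (c : ℂ) (η : L2T N) :
    maxFormR s v L (c • η) = ENNReal.ofReal (‖c‖ ^ 2) * maxFormR s v L η := by
  rw [maxFormR, maxFormR, maxForm_smul, depletion_smul, mul_left_comm, ENNReal.ofReal_mul (sq_nonneg _), mul_add]

/-- `maxFormR 0 = 0`. [folklore] -/
theorem maxFormR_zero (s : ℝ) (v : ℝ → ℝ≥0∞) (L : ℝ) : maxFormR s v L (0 : L2T N) = 0 := by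
  rw [maxFormR, maxForm_zero, depletion_zero, mul_zero, ENNReal.ofReal_zero, add_zero]

/-- **Parallelogram law of the rewarded maximal form** (`s ≥ 0`). [folklore] -/
theorem maxFormR_parallelogram {s : ℝ} (hs : 0 ≤ s) (hv : Measurable v) (L : ℝ) (η ξ : L2T N) :
    maxFormR s v L (η + ξ) + maxFormR s v L (η - ξ) = 2 * maxFormR s v L η + 2 * maxFormR s v L ξ := by
  simp only [maxFormR]
  have h2 : ∀ x : ℝ, 0 ≤ x → (2 : ℝ≥0∞) * ENNReal.ofReal x = ENNReal.ofReal (2 * x) := fun x _ => by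
    rw [ENNReal.ofReal_mul zero_le_two, ENNReal.ofReal_ofNat]
  have hη := mul_nonneg hs (depletion_nonneg (N := N) η)
  have hξ := mul_nonneg hs (depletion_nonneg (N := N) ξ)
  have hd : ENNReal.ofReal (s * depletion N (η + ξ)) + ENNReal.ofReal (s * depletion N (η - ξ)) =
      2 * ENNReal.ofReal (s * depletion N η) + 2 * ENNReal.ofReal (s * depletion N ξ) := by
    rw [h2 _ hη, h2 _ hξ, ← ENNReal.ofReal_add (mul_nonneg hs (depletion_nonneg _)) (mul_nonneg hs (depletion_nonneg _)),
      ← ENNReal.ofReal_add (by positivity) (by positivity), ← mul_add, depletion_parallelogram]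
    congr 1
    ring
  calc maxForm v L (η + ξ) + ENNReal.ofReal (s * depletion N (η + ξ)) +
        (maxForm v L (η - ξ) + ENNReal.ofReal (s * depletion N (η - ξ)))
      = (maxForm v L (η + ξ) + maxForm v L (η - ξ)) +
          (ENNReal.ofReal (s * depletion N (η + ξ)) + ENNReal.ofReal (s * depletion N (η - ξ))) := by ring
    _ = (2 * maxForm v L η + 2 * maxForm v L ξ) +
          (2 * ENNReal.ofReal (s * depletion N η) + 2 * ENNReal.ofReal (s * depletion N ξ)) := by
        rw [maxForm_parallelogram hv, hd]
    _ = _ := by ring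

section Rewarded

variable (hL : 0 < L) (hv : Measurable v) (hW : ∫⁻ X in cellN N L, periodicInteraction v L X ≠ ⊤)

/-- **The reward map on the form domain**: `√s · ((1 - Pᵢ) ι u)ᵢ`, so that `‖rewardG u‖² = s · dep(ι u)` and
the form domain of the rewarded form is `Q` with the graph norm of `rewardG`. [cite: Kato1966, Ch. VI §1.6] -/
def rewardG (s : ℝ) : formDomain hL hv hW →L[ℂ] PiLp 2 (fun _ : Fin N => L2T N) :=
  ((Real.sqrt s : ℝ) : ℂ) • (depMap N ∘L formEmbed hL hv hW)

/-- The form domain is a normed group (named instance of `Submodule.normedAddCommGroup`, so that instance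
search through `WithLp 2 (Q × _)` is cheap). [folklore] -/
instance formDomain.instNormedAddCommGroup : NormedAddCommGroup (formDomain hL hv hW) :=
  Submodule.normedAddCommGroup _

/-- The form domain is an inner product space (named instance of `Submodule.innerProductSpace`). [folklore] -/
instance formDomain.instInnerProductSpace : InnerProductSpace ℂ (formDomain hL hv hW) :=
  Submodule.innerProductSpace _

/-- **The rewarded form domain** (the graph of `rewardG s`) is a normed group (named instance, so that
`TwoModeData (graphEmbedding (formEmbed hL hv hW) (rewardG hL hv hW s))` elaborates). [folklore] -/
instance rewardSpace.instNormedAddCommGroup (s : ℝ) : NormedAddCommGroup (graphSpace (rewardG hL hv hW s)) :=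
  Submodule.normedAddCommGroup _

/-- The rewarded form domain is an inner product space (named instance). [folklore] -/
instance rewardSpace.instInnerProductSpace (s : ℝ) : InnerProductSpace ℂ (graphSpace (rewardG hL hv hW s)) :=
  Submodule.innerProductSpace _

/-- `‖rewardG s u‖² = s · depletion (ι u)` for `s ≥ 0`. [folklore] -/
theorem norm_rewardG_sq {s : ℝ} (hs : 0 ≤ s) (u : formDomain hL hv hW) :
    ‖rewardG hL hv hW s u‖ ^ 2 = s * depletion N (formEmbed hL hv hW u) := by
  rw [rewardG, _root_.smul_apply, norm_smul, mul_pow, Complex.norm_real, Real.norm_eq_abs, sq_abs,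
    Real.sq_sqrt hs, ContinuousLinearMap.comp_apply, norm_depMap_sq]

/-- **The rewarded energy of a periodic trial state**: `periodicEnergy v Ψ + s · dep(ιΨ)`
(`= ⟨Ψ, HΨ⟩ + s(N - ⟨Ψ, n̂₀Ψ⟩)`). [cite: ReedSimonIV1978, §XIII.12] -/
def rewardedEnergy (s : ℝ) (Ψ : PeriodicTrialState N L) : ℝ≥0∞ :=
  periodicEnergy v Ψ + ENNReal.ofReal (s * depletion N (formEmbed hL hv hW
    ⟨graphEmbed hL hv hW ⟨Ψ.ψ, Ψ.mem_periodicCore⟩, graphEmbed_mem_formDomain hL hv hW _⟩))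

/-- Unfolding `rewardedEnergy`. [folklore] -/
theorem rewardedEnergy_def (s : ℝ) (Ψ : PeriodicTrialState N L) :
    rewardedEnergy hL hv hW s Ψ = periodicEnergy v Ψ + ENNReal.ofReal (s * depletion N (formEmbed hL hv hW
      ⟨graphEmbed hL hv hW ⟨Ψ.ψ, Ψ.mem_periodicCore⟩, graphEmbed_mem_formDomain hL hv hW _⟩)) := rfl

/-- **The rewarded ground-state energy** `R(s) = inf_Ψ rewardedEnergy s Ψ`. [cite: ReedSimonIV1978, §XIII.12] -/
def rewardedGroundStateEnergy (s : ℝ) : ℝ≥0∞ := ⨅ Ψ : PeriodicTrialState N L, rewardedEnergy hL hv hW s Ψ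

/-- Unfolding `rewardedGroundStateEnergy` (made irreducible at the end of this file). [folklore] -/
theorem rewardedGroundStateEnergy_def (s : ℝ) :
    rewardedGroundStateEnergy hL hv hW s = ⨅ Ψ : PeriodicTrialState N L, rewardedEnergy hL hv hW s Ψ := rfl

/-- `R(s) ≤ rewardedEnergy s Ψ`. [folklore] -/
theorem rewardedGroundStateEnergy_le (s : ℝ) (Ψ : PeriodicTrialState N L) :
    rewardedGroundStateEnergy hL hv hW s ≤ rewardedEnergy hL hv hW s Ψ := iInf_le _ Ψ

/-- Lower bounds of all rewarded energies are lower bounds of `R(s)`. [folklore] -/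
theorem le_rewardedGroundStateEnergy {s : ℝ} {a : ℝ≥0∞} (h : ∀ Ψ : PeriodicTrialState N L, a ≤ rewardedEnergy hL hv hW s Ψ) :
    a ≤ rewardedGroundStateEnergy hL hv hW s := le_iInf h

/-- **The rewarded ground-state class**: Bose-symmetric classes with `maxFormR s v L η ≤ R(s) ‖η‖²`.
[cite: ReedSimonIV1978, §XIII.12] -/
def rewardedGroundStates (s : ℝ) : Set (L2T N) :=
  {η | η ∈ boseSymmetric N ∧ maxFormR s v L η ≤ rewardedGroundStateEnergy hL hv hW s * ENNReal.ofReal (‖η‖ ^ 2)}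

/-- Membership in the rewarded ground-state class. [folklore] -/
theorem mem_rewardedGroundStates {s : ℝ} {η : L2T N} :
    η ∈ rewardedGroundStates hL hv hW s ↔ η ∈ boseSymmetric N ∧
      maxFormR s v L η ≤ rewardedGroundStateEnergy hL hv hW s * ENNReal.ofReal (‖η‖ ^ 2) := Iff.rfl

end Rewarded

/-! ### Sealing the operator-valued definitions

The continuous linear maps `exciteProj`, `depMap`, `rewardG` unfold to very large terms (orthogonal
projections composed with the form embedding); to keep such unfolding out of unification downstream they
are made irreducible here — use `exciteProj_def`, `depMap_apply`, `norm_rewardG_sq` and the API above. The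
scalar-valued `depletion`, `depletionB`, `maxFormR`, `rewardedEnergy`, `rewardedGroundStateEnergy` and the
set `rewardedGroundStates` stay reducible (importers unfold them by `rfl`). -/

attribute [irreducible] exciteProj depMap rewardG

end Literature.MathematicalPhysics.QuantumManyBody.BoseGas

end
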